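import Summits.QuantumFields.YangMills.Theorems.LuscherReductionRunningReductionLatticeLinkKernel
import Summits.QuantumFields.YangMills.Theorems.LuscherReductionOneSiteLevelsIMS
import Summits.QuantumFields.YangMills.Theorems.LuscherReductionOneSiteLevelsLinkMoments
import HarnessLib

/-!
# The IMS localisation error of the transfer form on `(ℤ/L)³`, any `L`: defect rows of link-Lipschitz phases cost `|E|²Λ²·(3/β)·c_β^{|E|}`
# (sub-stub C1d of the fixed-lattice programme COARSE(L₀) — route `LuscherReduction`, crux RED stmt-QuantumFields-19978 KT-door 3b′ /
# crux `TwistedTraceScaling` stmt-QuantumFields-20203 S-BASE; card `pub/ym-fleet/ym-luscher-20007-p1/Lines-base-coarse-cut.md`)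

The IMS inequality for the transfer quadratic form is typed for every `L` in the tree (`qform_su2Rep_le_sum_localized_add`,
`Theorems/LuscherReductionOneSiteLevelsIMS.lean`): `⟨ψ,Kψ⟩ ≤ Σ_a ⟨J_aψ,KJ_aψ⟩ + ½M‖ψ‖²` with `M` a bound on the DEFECT ROWS
`∫ K_β(U,V) Σ_a(J_a(U) − J_a(V))² dV`.  Its one-site defect-row bound (`…OneSiteLevelsIMSDefect.lean`) is typed over `Cfg = GaugeConfig 3 1 SU2`;
this module is the `L`-generic twin, in the vocabulary of `…RunningReductionLatticeLinkKernel.lean` (`latE`, `latCE`):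

* `integral_latE_mul_frobSq_eq` — the mixed row integral `∫ E_β(U,V) ‖U_eV_e⁻¹ − 1‖_F² dV = linkM2 β · c_β^{|E|−1}` for every `U` and link `e`;
* `defectRow_le_lat` — for a link-Lipschitz phase `|Θ(U) − Θ(V)| ≤ Λ Σ_e ‖U_e − V_e‖_F`:
  `∫ K_β(U,V)(Θ(U) − Θ(V))² dV ≤ |E|²Λ² · linkM2 β · c_β^{|E|−1}` (`K ≤ E`, Cauchy–Schwarz over the `|E|` links);
* `defectRow_le_of_pos_lat` — with the tree's Laplace moment bound `linkM2 β ≤ (3/β) c_β`: `≤ |E|²Λ²(3/β) · latCE L β`;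
* `qform_le_localized_cos_sin_lat` — plugged into IMS with the angular partition `J = (cos Θ, sin Θ)`:
  `⟨ψ,K_βψ⟩ ≤ ⟨cosΘ ψ, K cosΘ ψ⟩ + ⟨sinΘ ψ, K sinΘ ψ⟩ + ½|E|²Λ²(3/β) latCE ‖ψ‖²` for every physical `ψ` and every measurable gauge- and
  twist-invariant link-Lipschitz phase `Θ` on the `L³` torus.

Scale bookkeeping (as at one site): cut-offs on link scale `ℓ` have `Λ ≍ 1/ℓ`, so the error is `≍ latCE·|E|²/(βℓ²)`; at `ℓ² ≍ λ_b = (2/β)^{1/3}`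
this is `O_L(λ_b²)·latCE`, below the level scale `λ_b·latCE·(λ₀/latCE)` since `λ₀/latCE → e^{−Σω/2} > 0` (the stiff Gaussian factor, not
proved here).  HONEST FRAMING: no choice of `Θ`, no bound on the localised pieces; femto rung R2b1; not a gap, not Clay.
-/

set_option autoImplicit false

noncomputable section

open MeasureTheory Filter Topology Real
open scoped Matrix ComplexConjugate BigOperators
open Literature.MathematicalPhysics.QuantumFieldTheory
open Literature.MathematicalPhysics.QuantumLattice

namespace Summit.QuantumFields.YangMills.Theorems.FemtoTransferGap

variable {L : ℕ} [NeZero L]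

/-! ### §1. Angular two-piece partitions on the `L³` torus -/

omit [NeZero L] in
/-- `cos²Θ + sin²Θ = 1` for the angular partition indexed by `Fin 2`. [folklore] -/
theorem sum_fin_two_cos_sin_sq_lat (Θ : GaugeConfig 3 L SU2 → ℝ) (U : GaugeConfig 3 L SU2) :
    ∑ a : Fin 2, (![Real.cos (Θ U), Real.sin (Θ U)] a) ^ 2 = 1 := by
  simp [Fin.sum_univ_two, Real.cos_sq_add_sin_sq]

omit [NeZero L] in
/-- `Σ_a (J_a(U) − J_a(V))² ≤ (Θ(U) − Θ(V))²` for the angular partition. [folklore] -/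
theorem sum_fin_two_cos_sin_sub_sq_le_lat (Θ : GaugeConfig 3 L SU2 → ℝ) (U V : GaugeConfig 3 L SU2) :
    ∑ a : Fin 2, (![Real.cos (Θ U), Real.sin (Θ U)] a - ![Real.cos (Θ V), Real.sin (Θ V)] a) ^ 2 ≤ (Θ U - Θ V) ^ 2 := by
  simp only [Fin.sum_univ_two, Matrix.cons_val_zero, Matrix.cons_val_one]
  have h1 : (Real.cos (Θ U) - Real.cos (Θ V)) ^ 2 + (Real.sin (Θ U) - Real.sin (Θ V)) ^ 2
      = 2 - 2 * Real.cos (Θ U - Θ V) := by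
    rw [Real.cos_sub]
    nlinarith [Real.cos_sq_add_sin_sq (Θ U), Real.cos_sq_add_sin_sq (Θ V)]
  rw [h1]
  have h2 := Real.one_sub_sq_div_two_le_cos (x := Θ U - Θ V)
  linarith

/-! ### §2. The mixed row integral `∫ E_β(U,V) ‖U_eV_e⁻¹ − 1‖² dV = linkM2 · c_β^{|E|−1}` -/

omit [NeZero L] in
/-- Per-link factor integrals of the mixed row integrand: `w_β(U_{e'}v⁻¹)`, times `‖U_e v⁻¹ − 1‖_F²` on the marked link. [folklore] -/
theorem integral_markedFactor_eq_lat (β : ℝ) (U : GaugeConfig 3 L SU2) (e e' : Edge 3 L) :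
    ∫ v, linkW β (U e' * v⁻¹) * (if e' = e then frobNorm (((U e' * v⁻¹ : SU2) : Matrix (Fin 2) (Fin 2) ℂ) - 1) ^ 2 else 1)
        ∂haarProbability SU2
      = if e' = e then linkM2 β else linkC β := by
  split_ifs with h
  · rw [linkM2]
    have := integral_comp_mul_inv_left
      (fun W : SU2 => frobNorm ((W : Matrix (Fin 2) (Fin 2) ℂ) - 1) ^ 2 * linkW β W) (U e')
    rw [← this]
    refine integral_congr_ae (ae_of_all _ fun v => ?_)
    simp only
    ring
  · simp only [mul_one]
    rw [linkC]
    exact integral_comp_mul_inv_left (linkW β) (U e')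

/-- **Mixed row integral on the `L³` torus**: `∫ E_β(U,V) ‖U_eV_e⁻¹ − 1‖_F² dV = linkM2 β · c_β^{|E|−1}`. [folklore] -/
theorem integral_latE_mul_frobSq_eq (β : ℝ) (U : GaugeConfig 3 L SU2) (e : Edge 3 L) :
    ∫ V, latE L β U V * frobNorm (((U e * (V e)⁻¹ : SU2) : Matrix (Fin 2) (Fin 2) ℂ) - 1) ^ 2 ∂configMeasure SU2 L
      = linkM2 β * linkC β ^ (Fintype.card (Edge 3 L) - 1) := by
  have hfac : ∀ V : GaugeConfig 3 L SU2, latE L β U V * frobNorm (((U e * (V e)⁻¹ : SU2) : Matrix (Fin 2) (Fin 2) ℂ) - 1) ^ 2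
      = ∏ e' : Edge 3 L, (linkW β (U e' * (V e')⁻¹) *
          (if e' = e then frobNorm (((U e' * (V e')⁻¹ : SU2) : Matrix (Fin 2) (Fin 2) ℂ) - 1) ^ 2 else 1)) := by
    intro V
    rw [Finset.prod_mul_distrib, latE]
    congr 1
    rw [Finset.prod_ite_eq' Finset.univ e]
    simp
  simp_rw [hfac]
  rw [show (∫ V, ∏ e' : Edge 3 L, (linkW β (U e' * (V e')⁻¹) *
          (if e' = e then frobNorm (((U e' * (V e')⁻¹ : SU2) : Matrix (Fin 2) (Fin 2) ℂ) - 1) ^ 2 else 1)) ∂configMeasure SU2 L)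
      = ∏ e' : Edge 3 L, ∫ v, linkW β (U e' * v⁻¹) *
          (if e' = e then frobNorm (((U e' * v⁻¹ : SU2) : Matrix (Fin 2) (Fin 2) ℂ) - 1) ^ 2 else 1) ∂haarProbability SU2 from
    integral_fintype_prod_eq_prod (fun e' v => linkW β (U e' * v⁻¹) *
      (if e' = e then frobNorm (((U e' * v⁻¹ : SU2) : Matrix (Fin 2) (Fin 2) ℂ) - 1) ^ 2 else 1))]
  simp_rw [integral_markedFactor_eq_lat]
  rw [← Finset.mul_prod_erase Finset.univ _ (Finset.mem_univ e), if_pos rfl,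
    Finset.prod_congr rfl (fun x hx => if_neg (Finset.ne_of_mem_erase hx)), Finset.prod_const,
    Finset.card_erase_of_mem (Finset.mem_univ e), Finset.card_univ]

/-! ### §3. The defect-row bound -/

/-- Cauchy–Schwarz over the links: `(Σ_e a_e)² ≤ |E| Σ_e a_e²`. [folklore] -/
theorem sq_sum_edge_le_lat (a : Edge 3 L → ℝ) : (∑ e, a e) ^ 2 ≤ Fintype.card (Edge 3 L) * ∑ e, a e ^ 2 := by
  have h := sq_sum_le_card_mul_sum_sq (s := (Finset.univ : Finset (Edge 3 L))) (f := a)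
  rw [Finset.card_univ] at h
  exact_mod_cast h

/-- **Defect-row bound on the `L³` torus.**  If `|Θ(U) − Θ(V)| ≤ Λ Σ_e ‖U_e − V_e‖_F`, then for `β ≥ 0` and every `U`:
`∫ K_β(U,V) (Θ(U) − Θ(V))² dV ≤ |E|² Λ² · linkM2 β · c_β^{|E|−1}`. [cite: SimonB1983DiscreteSpectrum, §3] -/
theorem defectRow_le_lat {β : ℝ} (hβ : 0 ≤ β) {Θ : GaugeConfig 3 L SU2 → ℝ} {Λ : ℝ}
    (hLip : ∀ U V : GaugeConfig 3 L SU2,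
      |Θ U - Θ V| ≤ Λ * ∑ e, frobNorm ((U e : Matrix (Fin 2) (Fin 2) ℂ) - (V e : Matrix (Fin 2) (Fin 2) ℂ)))
    (U : GaugeConfig 3 L SU2) :
    ∫ V, transferKernel su2Rep β U V * (Θ U - Θ V) ^ 2 ∂configMeasure SU2 L ≤
      (Fintype.card (Edge 3 L) : ℝ) ^ 2 * Λ ^ 2 * (linkM2 β * linkC β ^ (Fintype.card (Edge 3 L) - 1)) := by
  set E : ℕ := Fintype.card (Edge 3 L) with hE
  -- pointwise: K (ΔΘ)² ≤ E_β · |E|Λ² Σ_e ‖U_eV_e⁻¹ − 1‖²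
  have hpt : ∀ V : GaugeConfig 3 L SU2, transferKernel su2Rep β U V * (Θ U - Θ V) ^ 2
      ≤ ((E : ℝ) * Λ ^ 2) * ∑ e, latE L β U V * frobNorm (((U e * (V e)⁻¹ : SU2) : Matrix (Fin 2) (Fin 2) ℂ) - 1) ^ 2 := by
    intro V
    have h1 : (Θ U - Θ V) ^ 2 ≤ Λ ^ 2 * ((E : ℝ) * ∑ e, frobNorm (((U e * (V e)⁻¹ : SU2) : Matrix (Fin 2) (Fin 2) ℂ) - 1) ^ 2) := by
      have hL := hLip U V
      have h2 : (Θ U - Θ V) ^ 2 ≤ (Λ * ∑ e, frobNorm ((U e : Matrix (Fin 2) (Fin 2) ℂ) - (V e : Matrix (Fin 2) (Fin 2) ℂ))) ^ 2 := by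
        rw [← sq_abs (Θ U - Θ V)]
        exact pow_le_pow_left₀ (abs_nonneg _) hL 2
      have h3 := sq_sum_edge_le_lat fun e => frobNorm ((U e : Matrix (Fin 2) (Fin 2) ℂ) - (V e : Matrix (Fin 2) (Fin 2) ℂ))
      simp only [frobNorm_sub_eq_mul_inv] at h3
      calc (Θ U - Θ V) ^ 2 ≤ Λ ^ 2 * (∑ e, frobNorm ((U e : Matrix (Fin 2) (Fin 2) ℂ) - (V e : Matrix (Fin 2) (Fin 2) ℂ))) ^ 2 := by
            rw [mul_pow] at h2; exact h2
        _ ≤ Λ ^ 2 * ((E : ℝ) * ∑ e, frobNorm (((U e * (V e)⁻¹ : SU2) : Matrix (Fin 2) (Fin 2) ℂ) - 1) ^ 2) := by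
            refine mul_le_mul_of_nonneg_left ?_ (sq_nonneg _)
            have : (∑ e, frobNorm ((U e : Matrix (Fin 2) (Fin 2) ℂ) - (V e : Matrix (Fin 2) (Fin 2) ℂ))) ^ 2
                = (∑ e, frobNorm (((U e * (V e)⁻¹ : SU2) : Matrix (Fin 2) (Fin 2) ℂ) - 1)) ^ 2 := by
              congr 1
              exact Finset.sum_congr rfl fun e _ => frobNorm_sub_eq_mul_inv _ _
            rw [this]
            exact h3
    have hK := transferKernel_le_latE hβ U V
    calc transferKernel su2Rep β U V * (Θ U - Θ V) ^ 2
        ≤ latE L β U V * (Λ ^ 2 * ((E : ℝ) * ∑ e, frobNorm (((U e * (V e)⁻¹ : SU2) : Matrix (Fin 2) (Fin 2) ℂ) - 1) ^ 2)) :=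
          mul_le_mul hK h1 (sq_nonneg _) (latE_pos β U V).le
      _ = ((E : ℝ) * Λ ^ 2) * ∑ e, latE L β U V * frobNorm (((U e * (V e)⁻¹ : SU2) : Matrix (Fin 2) (Fin 2) ℂ) - 1) ^ 2 := by
          rw [← Finset.mul_sum]
          ring
  -- integrability of the majorant terms
  haveI := secondCountableTopology_su2
  have hint : ∀ e : Edge 3 L, Integrable (fun V : GaugeConfig 3 L SU2 =>
      latE L β U V * frobNorm (((U e * (V e)⁻¹ : SU2) : Matrix (Fin 2) (Fin 2) ℂ) - 1) ^ 2) (configMeasure SU2 L) := by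
    intro e
    have hm : Measurable fun V : GaugeConfig 3 L SU2 =>
        latE L β U V * frobNorm (((U e * (V e)⁻¹ : SU2) : Matrix (Fin 2) (Fin 2) ℂ) - 1) ^ 2 := by
      refine ((measurable_latE β).comp (measurable_const.prodMk measurable_id)).mul ?_
      have h1 : Measurable fun v : SU2 => frobNorm ((((U e) * v⁻¹ : SU2) : Matrix (Fin 2) (Fin 2) ℂ) - 1) ^ 2 :=
        ((continuous_frobNorm'.comp ((continuous_subtype_val.comp (continuous_const.mul continuous_inv)).sub
          continuous_const)).pow 2).measurable
      exact h1.comp (measurable_pi_apply e)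
    refine Integrable.mono' (integrable_const (Real.exp (2 * β) ^ Fintype.card (Edge 3 L) * 8))
      hm.aestronglyMeasurable (ae_of_all _ fun V => ?_)
    rw [Real.norm_eq_abs, abs_mul, abs_of_pos (latE_pos β U V), abs_of_nonneg (sq_nonneg _)]
    exact mul_le_mul (latE_le hβ U V) (frobNorm_sub_one_sq_le_eight _) (sq_nonneg _) (by positivity)
  calc ∫ V, transferKernel su2Rep β U V * (Θ U - Θ V) ^ 2 ∂configMeasure SU2 L
      ≤ ∫ V, ((E : ℝ) * Λ ^ 2) * ∑ e, latE L β U V * frobNorm (((U e * (V e)⁻¹ : SU2) : Matrix (Fin 2) (Fin 2) ℂ) - 1) ^ 2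
          ∂configMeasure SU2 L := by
        refine integral_mono_of_nonneg (ae_of_all _ fun V => ?_)
          ((integrable_finsetSum _ fun e _ => hint e).const_mul _) (ae_of_all _ hpt)
        exact mul_nonneg (transferKernel_pos su2Rep β U V).le (sq_nonneg _)
    _ = ((E : ℝ) * Λ ^ 2) * ∑ e : Edge 3 L, linkM2 β * linkC β ^ (E - 1) := by
        rw [integral_const_mul, integral_finsetSum _ fun e _ => hint e]
        congr 1
        exact Finset.sum_congr rfl fun e _ => integral_latE_mul_frobSq_eq β U e
    _ = (E : ℝ) ^ 2 * Λ ^ 2 * (linkM2 β * linkC β ^ (E - 1)) := by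
        rw [Finset.sum_const, Finset.card_univ, nsmul_eq_mul]
        ring

/-- The defect-row bound with the tree's Laplace estimate `linkM2 β ≤ (3/β) c_β` (`β > 0`):
`∫ K_β(U,V) (Θ(U) − Θ(V))² dV ≤ |E|² Λ² (3/β) · c_β^{|E|}`. [cite: SimonB1983DiscreteSpectrum, §3] -/
theorem defectRow_le_of_pos_lat {β : ℝ} (hβ : 0 < β) {Θ : GaugeConfig 3 L SU2 → ℝ} {Λ : ℝ}
    (hLip : ∀ U V : GaugeConfig 3 L SU2,
      |Θ U - Θ V| ≤ Λ * ∑ e, frobNorm ((U e : Matrix (Fin 2) (Fin 2) ℂ) - (V e : Matrix (Fin 2) (Fin 2) ℂ)))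
    (U : GaugeConfig 3 L SU2) :
    ∫ V, transferKernel su2Rep β U V * (Θ U - Θ V) ^ 2 ∂configMeasure SU2 L ≤
      (Fintype.card (Edge 3 L) : ℝ) ^ 2 * Λ ^ 2 * (3 / β) * latCE L β := by
  have h := defectRow_le_lat hβ.le hLip U
  have hM := linkM2_le_three_div hβ
  have hc := (linkC_pos hβ.le).le
  have hE : 1 ≤ Fintype.card (Edge 3 L) := Fintype.card_pos_iff.2 ⟨((0 : Site 3 L), (0 : Fin 3))⟩
  have hCE : latCE L β = linkC β * linkC β ^ (Fintype.card (Edge 3 L) - 1) := by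
    rw [latCE, ← pow_succ', Nat.sub_add_cancel hE]
  calc ∫ V, transferKernel su2Rep β U V * (Θ U - Θ V) ^ 2 ∂configMeasure SU2 L
      ≤ (Fintype.card (Edge 3 L) : ℝ) ^ 2 * Λ ^ 2 * (linkM2 β * linkC β ^ (Fintype.card (Edge 3 L) - 1)) := h
    _ ≤ (Fintype.card (Edge 3 L) : ℝ) ^ 2 * Λ ^ 2 * (3 / β * linkC β * linkC β ^ (Fintype.card (Edge 3 L) - 1)) := by
        refine mul_le_mul_of_nonneg_left (mul_le_mul_of_nonneg_right hM (pow_nonneg hc _)) (by positivity)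
    _ = (Fintype.card (Edge 3 L) : ℝ) ^ 2 * Λ ^ 2 * (3 / β) * latCE L β := by rw [hCE]; ring

/-! ### §4. Plugged into the IMS inequality -/

/-- ★ **IMS on the `L³` torus with an angular two-piece partition driven by a link-Lipschitz physical phase.**  For `β > 0`, a measurable,
gauge- and twist-invariant phase `Θ` with `|Θ(U) − Θ(V)| ≤ Λ Σ_e ‖U_e − V_e‖_F` (`Λ ≥ 0`), and every physical `ψ`:
`⟨ψ,K_βψ⟩ ≤ ⟨(cos Θ)ψ, K_β (cos Θ)ψ⟩ + ⟨(sin Θ)ψ, K_β (sin Θ)ψ⟩ + ½·|E|²Λ²(3/β)·c_β^{|E|}·‖ψ‖²`. [cite: SimonB1983DiscreteSpectrum, §3] -/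
theorem qform_le_localized_cos_sin_lat {β : ℝ} (hβ : 0 < β) {Θ : GaugeConfig 3 L SU2 → ℝ} (hΘm : Measurable Θ) {Λ : ℝ} (hΛ : 0 ≤ Λ)
    (hLip : ∀ U V : GaugeConfig 3 L SU2,
      |Θ U - Θ V| ≤ Λ * ∑ e, frobNorm ((U e : Matrix (Fin 2) (Fin 2) ℂ) - (V e : Matrix (Fin 2) (Fin 2) ℂ)))
    (hΘg : ∀ (g : Site 3 L → SU2) (U : GaugeConfig 3 L SU2), Θ (gaugeTransform g U) = Θ U)
    (hΘz : ∀ (k : Fin 3), ∀ z ∈ Subgroup.center SU2, ∀ U : GaugeConfig 3 L SU2, Θ (twist k z U) = Θ U)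
    {ψ : GaugeConfig 3 L SU2 → ℝ} (hψ : IsPhys ψ) :
    qform su2Rep β ψ ψ ≤ qform su2Rep β (fun U => Real.cos (Θ U) * ψ U) (fun U => Real.cos (Θ U) * ψ U)
      + qform su2Rep β (fun U => Real.sin (Θ U) * ψ U) (fun U => Real.sin (Θ U) * ψ U)
      + (1 / 2) * ((Fintype.card (Edge 3 L) : ℝ) ^ 2 * Λ ^ 2 * (3 / β) * latCE L β) * l2 ψ ψ := by
  set J : Fin 2 → GaugeConfig 3 L SU2 → ℝ := fun a U => ![Real.cos (Θ U), Real.sin (Θ U)] a with hJ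
  have hJm : ∀ a, Measurable (J a) := by
    intro a
    fin_cases a
    · exact Real.continuous_cos.measurable.comp hΘm
    · exact Real.continuous_sin.measurable.comp hΘm
  have hJsum : ∀ U, ∑ a, J a U ^ 2 = 1 := fun U => sum_fin_two_cos_sin_sq_lat Θ U
  have hJg : ∀ a (g : Site 3 L → SU2) (U : GaugeConfig 3 L SU2), J a (gaugeTransform g U) = J a U := by
    intro a g U; simp only [hJ, hΘg g U]
  have hJz : ∀ a (k : Fin 3), ∀ z ∈ Subgroup.center SU2, ∀ U : GaugeConfig 3 L SU2, J a (twist k z U) = J a U := by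
    intro a k z hz U; simp only [hJ, hΘz k z hz U]
  have hM : ∀ U : GaugeConfig 3 L SU2, ∫ V, transferKernel su2Rep β U V * ∑ a, (J a U - J a V) ^ 2 ∂configMeasure SU2 L
      ≤ (Fintype.card (Edge 3 L) : ℝ) ^ 2 * Λ ^ 2 * (3 / β) * latCE L β := by
    intro U
    refine le_trans ?_ (defectRow_le_of_pos_lat hβ hLip U)
    haveI := secondCountableTopology_su2
    refine integral_mono_of_nonneg (ae_of_all _ fun V => ?_) ?_ (ae_of_all _ fun V => ?_)
    · exact mul_nonneg (transferKernel_pos su2Rep β U V).le (Finset.sum_nonneg fun a _ => sq_nonneg _)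
    · -- integrable majorant: bounded measurable on a probability space
      have hm : Measurable fun V : GaugeConfig 3 L SU2 => transferKernel su2Rep β U V * (Θ U - Θ V) ^ 2 :=
        ((measurable_transferKernel_lat β).comp (measurable_const.prodMk measurable_id)).mul
          ((measurable_const.sub hΘm).pow_const 2)
      obtain ⟨Mk, hMk⟩ := exists_transferKernel_le su2Rep continuous_su2Rep β (L := L)
      have hbd : ∀ V : GaugeConfig 3 L SU2, (Θ U - Θ V) ^ 2 ≤ (Λ * (Fintype.card (Edge 3 L) * Real.sqrt 8)) ^ 2 := by
        intro V
        have hL := hLip U V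
        have hs : ∑ e, frobNorm ((U e : Matrix (Fin 2) (Fin 2) ℂ) - (V e : Matrix (Fin 2) (Fin 2) ℂ)) ≤
            Fintype.card (Edge 3 L) * Real.sqrt 8 := by
          have h8 : ∀ e : Edge 3 L, frobNorm ((U e : Matrix (Fin 2) (Fin 2) ℂ) - (V e : Matrix (Fin 2) (Fin 2) ℂ)) ≤ Real.sqrt 8 := by
            intro e
            rw [frobNorm_sub_eq_mul_inv]
            have h := frobNorm_sub_one_sq_le_eight (U e * (V e)⁻¹)
            rw [← Real.sqrt_le_sqrt_iff (by norm_num : (0:ℝ) ≤ 8)] at h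
            rwa [Real.sqrt_sq (frobNorm_nonneg _)] at h
          calc ∑ e, frobNorm ((U e : Matrix (Fin 2) (Fin 2) ℂ) - (V e : Matrix (Fin 2) (Fin 2) ℂ))
              ≤ ∑ _e : Edge 3 L, Real.sqrt 8 := Finset.sum_le_sum fun e _ => h8 e
            _ = Fintype.card (Edge 3 L) * Real.sqrt 8 := by rw [Finset.sum_const, Finset.card_univ, nsmul_eq_mul]
        have h1 : |Θ U - Θ V| ≤ Λ * (Fintype.card (Edge 3 L) * Real.sqrt 8) := hL.trans (mul_le_mul_of_nonneg_left hs hΛ)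
        rw [← sq_abs (Θ U - Θ V)]
        exact pow_le_pow_left₀ (abs_nonneg _) h1 2
      refine Integrable.mono' (integrable_const (Mk * (Λ * (Fintype.card (Edge 3 L) * Real.sqrt 8)) ^ 2)) hm.aestronglyMeasurable
        (ae_of_all _ fun V => ?_)
      rw [Real.norm_eq_abs, abs_mul, abs_of_pos (transferKernel_pos su2Rep β U V), abs_of_nonneg (sq_nonneg _)]
      exact mul_le_mul (hMk U V) (hbd V) (sq_nonneg _) ((transferKernel_pos su2Rep β U V).le.trans (hMk U V))
    · exact mul_le_mul_of_nonneg_left (sum_fin_two_cos_sin_sub_sq_le_lat Θ U V) (transferKernel_pos su2Rep β U V).le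
  have h := qform_su2Rep_le_sum_localized_add β J hJm hJsum hJg hJz hM hψ
  simp only [hJ, Fin.sum_univ_two, Matrix.cons_val_zero, Matrix.cons_val_one] at h
  exact h

end Summit.QuantumFields.YangMills.Theorems.FemtoTransferGap

end
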